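import Summits.BirchSwinnertonDyer.BirchSwinnertonDyer.Theorems.ByReductionTypeAtTwoAdditivePotGoodLowerHalfT0NarrowRankLayerParityStep
import Summits.BirchSwinnertonDyer.BirchSwinnertonDyer.Theorems.ByReductionTypeAtTwoAdditivePotGoodLowerHalfT0NarrowRankLayerBoundsRow293200be1
import Summits.BirchSwinnertonDyer.BirchSwinnertonDyer.Theorems.ByReductionTypeAtTwoFineSelmerConjAAtTwoAdditivePotGoodChevalleyStampsA
import Summits.BirchSwinnertonDyer.BirchSwinnertonDyer.Theorems.ByReductionTypeAtTwoFineSelmerConjAAtTwoAdditivePotGoodCoinvariantGenusCertificate733LayerOne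
import Summits.BirchSwinnertonDyer.BirchSwinnertonDyer.Theorems.ByReductionTypeAtTwoAdditivePotMultConjATwoNarrowRoadKitSquares
import HarnessLib

/-!
# K4 crux `AdditiveRankZeroAtTwo` (19098), children C3″ `AdditivePotGoodLowerHalfAtTwo` (22617) / C1″ (22615): census row `293200be1` — the displayed parity `hK`
# of the rung-`m = 2` stamp `conjA_two_293200be1_of_layerBounds₂₃` DISCHARGED IN THE KERNEL: `h(A₂) = h(ℚ(θ) ⊔ ℚ_2)` is ODD
# (`h(ℚ(θ)) = 1` → `h(A₁)` odd by Chevalley's one-bit door → `h(A₂)` odd by the parity step with k4-w1's sextic non-norm unit; row of discriminant `733`)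
# (seat `bsd-2adic-k4-w2` GEN 15; `--supports stmt-BirchSwinnertonDyer-22617 --as helper`)

Cell `bsd-2adic`.  THEOREMS ONLY (no definition, no named fact, no `sorry`).  KERNEL chain for the totally real cubic point field `K = ℚ(θ)`,
`θ³ + (-1)θ² + (-7)θ + (8) = 0` (`d = 733`, `h = 1`, two primes above `2`, Fukuda index `0`): (i) `h(A₁)` odd — k4-w1's one-bit door
`layerOneBit_of_chevalleyCert` (the cubic unit certificate of `…ChevalleyStampsA`: a unit `≡ ±3 (mod 8)` at the unramified degree-`1` dyadic prime, at most two primes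
above `2`) + k4-w3's `odd_classNumber_sup_layer_one_of_layerOneBit`; (ii) `h(A₂)` odd — GEN 15's generic parity step `odd_classNumber_sup_layer_succ_of_nonNormUnit`
at `m = 1` (at most two dyadic primes of `A₁` ramify in `A₂ = A₁(√(2+√2))`, no infinite place; Chevalley) fed with k4-w1 GEN 12's MODEL-FREE sextic non-norm unit
`exists_unit_forall_sq_sub_mul_sq_ne_d733` (a unit of `𝓞 A₁` with `a² − (2 + s)c² ≠ η` for all `a, c ∈ A₁`, any `s` with `s² = 2`; O'Meara 63:10 at the dyadic prime with
`e = 2`).  Then §3 re-keys the row: ★ `conjA_two_293200be1_of_layerBounds₂₃'` displays only (hL) `h(A₃)` odd, (hlow) `2^2 ≤ #(U⁺/U²)(A₂)`, (hsig) `2^22 ≤ #sign(U_{A₃})`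
(three VALUED GRH-free data, eng-2 CERT-NARROW6-E2 v1.3 §6.1), and the BSD₂ rungs follow.  Matches eng-2 v1.3 (`h(K₂) = 1` by a quotient certificate); here KERNEL.

HONEST FRAMING (D-0036 / D-0054 / D-0152): conditional theorems (three instrument-tier data + PRINT inputs of the rungs); closes nothing at the `∀`-level
(C3″ 22617 / C1″ 22615 research-open); nothing booked; census tier of the row unchanged (CERT, hypothesis count 4 → 3); BSD is not proved by any of this.

References: [Lang1990] Ch. 13 §4 Lemma 4.1; [Gras2003] IV.4; [Omeara1963] §63B (63:10); [Washington1997] §13.1; [EdgarMollinPeterson1986] Thm. 2.1;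
[CoatesSujatha2005] (A), Thm. 3.4; [Kato2004Asterisque] Thm. 12.5 (1)(3), 13.8, 14.14; [Cassels1965ArithmeticVIII] Thm. 1.3; [Miller2011LMS] Def. 1.1.
-/

set_option autoImplicit false
-- the Theorems namespace of this sub repeats the summit name by design (D-0017 nested layout)
set_option linter.dupNamespace false

noncomputable section

open scoped Classical IntermediateField NumberField Real nonZeroDivisors

/-! ## §1–§2 The parities `h(A₁)`, `h(A₂)` odd (namespace `AddKatoTwo`) -/

namespace Summit.BirchSwinnertonDyer.BirchSwinnertonDyer.Theorems.AddKatoTwo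

open WeierstrassCurve Field Polynomial IsDedekindDomain NumberField Matrix Literature.NumberTheory.EllipticCurves
  Literature.NumberTheory.EllipticCurves.ZpExtension
  Literature.NumberTheory.GaloisRepresentations
  Literature.NumberTheory.IwasawaTheory
  Literature.NumberTheory.NumberFields
  Literature.Geometry.Kaehler.ComplexTorus
  Summit.BirchSwinnertonDyer.BirchSwinnertonDyer.Theorems.SteinbergFibreAtTwo
  Summit.BirchSwinnertonDyer.BirchSwinnertonDyer.Theorems.AlignedTransportAtTwoTorsionPointField
  Summit.BirchSwinnertonDyer.BirchSwinnertonDyer.Theses.ByReductionTypeAtTwo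

section Row

variable {θ : AlgebraicClosure ℚ}

set_option maxHeartbeats 1600000 in
/-- **`h(A₁) = h(ℚ(θ) ⊔ ℚ_1)` is ODD for `θ³ + (-1)θ² + (-7)θ + (8) = 0`** (`A₁ = ℚ(θ, √2)`): Chevalley's one-bit door at `2` (k4-w1 `layerOneBit_of_chevalleyCert`,
certificate data of `…ChevalleyStampsA`: `h(ℚ(θ)) = 1`, the unit `(5 + (-2)θ + (0)θ²)/1` with monic cubic `⟨1, -13, 27, 1⟩` and `2`-adic image `≡ ±3 (mod 8)`, at most
two primes above `2`) read on the concrete layer by k4-w3's `odd_classNumber_sup_layer_one_of_layerOneBit`.  KERNEL.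
[cite: Lang1990, Ch. 13 §4, Lemma 4.1 (PDF pp. 203–204)] [cite: Washington1997, §13.1] -/
theorem odd_classNumber_sup_layer_one_disc733_lb (hθ : aeval θ (Cubic.toPoly ⟨1, ((-1 : ℤ) : ℚ), ((-7 : ℤ) : ℚ), ((8 : ℤ) : ℚ)⟩) = 0) :
    haveI : FiniteDimensional ℚ ↥ℚ⟮θ⟯ :=
      IntermediateField.adjoin.finiteDimensional ⟨_, Cubic.monic_of_a_eq_one', by rwa [← aeval_def]⟩
    haveI : FiniteDimensional ℚ ↥((CyclotomicZp.zpExtension 2).layer 1) := (CyclotomicZp.zpExtension 2).finiteDimensional_layer_holds 1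
    haveI : NumberField ↥(ℚ⟮θ⟯ ⊔ (CyclotomicZp.zpExtension 2).layer 1) := NumberField.mk
    Odd (classNumber ↥(ℚ⟮θ⟯ ⊔ (CyclotomicZp.zpExtension 2).layer 1)) := by
  have hθ' : θ ^ 3 + (-1 : AlgebraicClosure ℚ) * θ ^ 2 + (-7 : AlgebraicClosure ℚ) * θ + (8 : AlgebraicClosure ℚ) = 0 := by
    have := hθ
    simp only [Cubic.toPoly, map_one, one_mul, aeval_add, aeval_mul, aeval_C, aeval_X_pow, aeval_X,
      eq_ratCast, Rat.cast_intCast] at this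
    push_cast at this
    linear_combination this
  have he : aeval (algebraMap ℚ (AlgebraicClosure ℚ) (((5 : ℤ) : ℚ) / ((1 : ℤ) : ℚ)) +
      algebraMap ℚ (AlgebraicClosure ℚ) (((-2 : ℤ) : ℚ) / ((1 : ℤ) : ℚ)) * θ +
      algebraMap ℚ (AlgebraicClosure ℚ) (((0 : ℤ) : ℚ) / ((1 : ℤ) : ℚ)) * θ ^ 2)
      (Cubic.toPoly ⟨1, ((-13 : ℤ) : ℚ), ((27 : ℤ) : ℚ), ((1 : ℤ) : ℚ)⟩) = 0 := by
    simp only [Cubic.toPoly, map_one, one_mul, aeval_add, aeval_mul, aeval_C, aeval_X_pow, aeval_X, eq_ratCast,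
      Rat.cast_intCast, Rat.cast_div]
    push_cast
    linear_combination ((-8 : AlgebraicClosure ℚ) + (0 : AlgebraicClosure ℚ) * θ + (0 : AlgebraicClosure ℚ) * θ ^ 2 + (0 : AlgebraicClosure ℚ) * θ ^ 3) * hθ'
  exact odd_classNumber_sup_layer_one_of_layerOneBit irreducible_cubic_disc_733 hθ
    (layerOneBit_of_chevalleyCert irreducible_cubic_disc_733 hθ (by rw [card_classGroup_adjoin_eq_one_disc_733 hθ]; norm_num) ⟨1, by norm_num⟩ ⟨0, by norm_num⟩
      (5) (-2) (0) (1) (-13) (27) (1) (by norm_num) he (0) (1) (by norm_num) (by norm_num) (by decide) (by decide))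

set_option maxHeartbeats 1600000 in
set_option synthInstance.maxHeartbeats 200000 in
/-- ★ **`h(A₂) = h(ℚ(θ) ⊔ ℚ_2)` is ODD for `θ³ + (-1)θ² + (-7)θ + (8) = 0`** (`A₂ = ℚ(θ, √(2+√2))`, degree `12`): the generic parity step
`odd_classNumber_sup_layer_succ_of_nonNormUnit` at `m = 1` — `h(A₁)` odd (§1), Fukuda index `0` (`forall_totallyRamifiedFrom_zero_h293200be1`), at most two primes of
`ℚ(θ)` above `2` (`ncard_primes_above_two_le_two` with the `4 ∤ g(·)` witnesses), and for every `s ∈ A₁` with `s² = 2` k4-w1's MODEL-FREE sextic non-norm unit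
`exists_unit_forall_sq_sub_mul_sq_ne_d733` (`a² − (2 + s)c² ≠ η`).  KERNEL; discharges the displayed `hK` of `conjA_two_293200be1_of_layerBounds₂₃` (eng-2 v1.3: `h(K₂) = 1`).
[cite: Lang1990, Ch. 13 §4, Lemma 4.1 (PDF pp. 203–204)] [cite: Gras2003, IV.4] [cite: Omeara1963, §63B (63:10)] [cite: Washington1997, §13.1 Prop. 13.2] -/
theorem odd_classNumber_sup_layer_two_disc733_lb (hθ : aeval θ (Cubic.toPoly ⟨1, ((-1 : ℤ) : ℚ), ((-7 : ℤ) : ℚ), ((8 : ℤ) : ℚ)⟩) = 0) :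
    haveI : FiniteDimensional ℚ ↥ℚ⟮θ⟯ :=
      IntermediateField.adjoin.finiteDimensional ⟨_, Cubic.monic_of_a_eq_one', by rwa [← aeval_def]⟩
    haveI : FiniteDimensional ℚ ↥((CyclotomicZp.zpExtension 2).layer 2) := (CyclotomicZp.zpExtension 2).finiteDimensional_layer_holds 2
    haveI : NumberField ↥(ℚ⟮θ⟯ ⊔ (CyclotomicZp.zpExtension 2).layer 2) := NumberField.mk
    Odd (classNumber ↥(ℚ⟮θ⟯ ⊔ (CyclotomicZp.zpExtension 2).layer 2)) := by
  haveI : Fact (Nat.Prime 2) := ⟨Nat.prime_two⟩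
  haveI : FiniteDimensional ℚ ↥ℚ⟮θ⟯ :=
    IntermediateField.adjoin.finiteDimensional ⟨_, Cubic.monic_of_a_eq_one', by rwa [← aeval_def]⟩
  haveI : FiniteDimensional ℚ ↥((CyclotomicZp.zpExtension 2).layer 1) := (CyclotomicZp.zpExtension 2).finiteDimensional_layer_holds 1
  haveI : NumberField ↥ℚ⟮θ⟯ := NumberField.mk
  haveI : NumberField ↥(ℚ⟮θ⟯ ⊔ (CyclotomicZp.zpExtension 2).layer 1) := NumberField.mk
  have h3 : Module.finrank ℚ ↥ℚ⟮θ⟯ = 3 := finrank_adjoin_eq_three_of_irreducible irreducible_cubic_disc_733 hθ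
  obtain ⟨b, -, hb⟩ := exists_ringOfIntegers_cubic_root (p := -1) (q := -7) (r := 8) hθ
  have h2 : {w : HeightOneSpectrum (𝓞 ↥ℚ⟮θ⟯) | ((2 : ℕ) : 𝓞 ↥ℚ⟮θ⟯) ∈ w.asIdeal}.ncard ≤ 2 :=
    ncard_primes_above_two_le_two ↥ℚ⟮θ⟯ h3 b irreducible_cubic_disc_733 hb ⟨1, by norm_num⟩ ⟨0, by norm_num⟩
  obtain ⟨-, hfin1, -⟩ := layer_basics irreducible_cubic_disc_733 hθ (isTotallyReal_adjoin_disc733_lb hθ) 1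
  -- `A₁` as a `ℚ(θ)`-algebra of degree `2`
  have hK1 : ℚ⟮θ⟯ ≤ ℚ⟮θ⟯ ⊔ (CyclotomicZp.zpExtension 2).layer 1 := le_sup_left
  letI : Algebra ↥ℚ⟮θ⟯ ↥(ℚ⟮θ⟯ ⊔ (CyclotomicZp.zpExtension 2).layer 1) := (IntermediateField.inclusion hK1).toRingHom.toAlgebra
  haveI : IsScalarTower ℚ ↥ℚ⟮θ⟯ ↥(ℚ⟮θ⟯ ⊔ (CyclotomicZp.zpExtension 2).layer 1) :=
    IsScalarTower.of_algebraMap_eq fun x => ((IntermediateField.inclusion hK1).commutes x).symm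
  haveI : Module.Finite ↥ℚ⟮θ⟯ ↥(ℚ⟮θ⟯ ⊔ (CyclotomicZp.zpExtension 2).layer 1) := Module.Finite.of_restrictScalars_finite ℚ _ _
  have hdeg : Module.finrank ↥ℚ⟮θ⟯ ↥(ℚ⟮θ⟯ ⊔ (CyclotomicZp.zpExtension 2).layer 1) = 2 := by
    have htower := Module.finrank_mul_finrank ℚ ↥ℚ⟮θ⟯ ↥(ℚ⟮θ⟯ ⊔ (CyclotomicZp.zpExtension 2).layer 1)
    rw [h3, hfin1] at htower
    omega
  refine odd_classNumber_sup_layer_succ_of_nonNormUnit irreducible_cubic_disc_733 hθ (isTotallyReal_adjoin_disc733_lb hθ)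
    (forall_totallyRamifiedFrom_zero_h293200be1 hθ) h2 1 le_rfl (odd_classNumber_sup_layer_one_disc733_lb hθ) ?_
  intro _ t ht
  have ht2 : t ^ 2 = 2 := by
    simp only [Function.iterate_one] at ht
    exact sub_eq_zero.mp ht
  exact exists_unit_forall_sq_sub_mul_sq_ne_d733 ↥ℚ⟮θ⟯ ↥(ℚ⟮θ⟯ ⊔ (CyclotomicZp.zpExtension 2).layer 1) h3 hdeg b hb t ht2

/-- ★ **(A) at `2` for `293200be1` with `hK` DISCHARGED: three displayed data (hL) `h(A₃)` odd, (hlow) `2^2 ≤ #(U⁺/U²)(A₂)`, (hsig) `2^22 ≤ #sign(U_{A₃})`**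
(all VALUED GRH-free by eng-2 CERT-NARROW6-E2 v1.3 §6.1; instrument tier): `conjA_two_293200be1_of_layerBounds₂₃` with `hK := odd_classNumber_sup_layer_two_disc733_lb hθ`.
BSD for `293200be1` is NOT proved by this. [cite: EdgarMollinPeterson1986, Thm. 2.1, p. 34] [cite: Fukuda1994, Thm. 1 (2), p. 264] [cite: CoatesSujatha2005, Conj. A and Thm. 3.4] -/
theorem conjA_two_293200be1_of_layerBounds₂₃'
    (hθ : aeval θ (Cubic.toPoly ⟨1, ((-1 : ℤ) : ℚ), ((-7 : ℤ) : ℚ), ((8 : ℤ) : ℚ)⟩) = 0)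
    (hL : ∀ [NumberField ↥(ℚ⟮θ⟯ ⊔ (CyclotomicZp.zpExtension 2).layer (2 + 1))],
      Odd (classNumber ↥(ℚ⟮θ⟯ ⊔ (CyclotomicZp.zpExtension 2).layer (2 + 1))))
    (hlow : ∀ [NumberField ↥(ℚ⟮θ⟯ ⊔ (CyclotomicZp.zpExtension 2).layer 2)],
      2 ^ 2 ≤ Nat.card (TotPosUnitsModSq ↥(ℚ⟮θ⟯ ⊔ (CyclotomicZp.zpExtension 2).layer 2)))
    (hsig : ∀ [NumberField ↥(ℚ⟮θ⟯ ⊔ (CyclotomicZp.zpExtension 2).layer (2 + 1))],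
      2 ^ 22 ≤ Nat.card (Set.range (signVec (K := ↥(ℚ⟮θ⟯ ⊔ (CyclotomicZp.zpExtension 2).layer (2 + 1))))))
    (κ : ZpExtension ℚ 2) (hκ : κ.IsCyclotomic) :
    haveI := (isElliptic_cubicModel _ _ _ (by simp only [Cubic.discr]; norm_num) : (⟨0, ((1 : ℤ) : ℚ), 0, ((-3388217033 : ℤ) : ℚ), ((-75912170159062 : ℤ) : ℚ)⟩ : WeierstrassCurve ℚ).IsElliptic)
    ∃ (γ : absoluteGaloisGroup ℚ) (D : (⟨0, ((1 : ℤ) : ℚ), 0, ((-3388217033 : ℤ) : ℚ), ((-75912170159062 : ℤ) : ℚ)⟩ : WeierstrassCurve ℚ).FineSelmerDualData κ γ),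
      Module.Finite ℤ_[2] (RestrictScalars ℤ_[2] (IwasawaAlgebra 2) D.X) :=
  conjA_two_293200be1_of_layerBounds₂₃ hθ (odd_classNumber_sup_layer_two_disc733_lb hθ) hL hlow hsig κ hκ

end Row

end Summit.BirchSwinnertonDyer.BirchSwinnertonDyer.Theorems.AddKatoTwo

/-! ## §3 The C3″ rungs with `hK` discharged (namespace `AddPotGoodInstances`) -/

namespace Summit.BirchSwinnertonDyer.BirchSwinnertonDyer.Theorems.AddPotGoodInstances

open WeierstrassCurve Polynomial NumberField Literature.NumberTheory.EllipticCurves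
  Literature.NumberTheory.IwasawaTheory
  Literature.NumberTheory.NumberFields
  Literature.Geometry.Kaehler.ComplexTorus
  Literature.NumberTheory.EllipticCurves.Rank1Residual
  Literature.NumberTheory.EllipticCurves.Rank1Residual.Typed
  Summit.BirchSwinnertonDyer.Rank1Residual
  Summit.BirchSwinnertonDyer.Rank1Residual.Additive
  Summit.BirchSwinnertonDyer.BirchSwinnertonDyer.Theorems

/-- Model transport for (A) at `2` in the `∃ γ D` spelling (the statement only depends on the Weierstrass CURVE).
[cite: CoatesSujatha2005, statement (A)] -/
private theorem conjA_two_of_eq_lp293200be1 {W W' : WeierstrassCurve ℚ} (h : W' = W)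
    (H : ∀ (κ : ZpExtension ℚ 2), κ.IsCyclotomic →
      ∃ (γ : Field.absoluteGaloisGroup ℚ) (D : W'.FineSelmerDualData κ γ), Module.Finite ℤ_[2] (RestrictScalars ℤ_[2] (IwasawaAlgebra 2) D.X)) :
    ∀ (κ : ZpExtension ℚ 2), κ.IsCyclotomic →
      ∃ (γ : Field.absoluteGaloisGroup ℚ) (D : W.FineSelmerDualData κ γ), Module.Finite ℤ_[2] (RestrictScalars ℤ_[2] (IwasawaAlgebra 2) D.X) := by
  subst h; exact H

/-- **(A) at `(293200be1, 2)` for the Cremona model from the THREE remaining layer data (`hK` discharged), NO print fact.** [cite: CoatesSujatha2005, statement (A)] -/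
theorem conjA_two_293200be1_of_layerBounds₂₃'_kernelLit
    {θ : AlgebraicClosure ℚ} (hθ : aeval θ (Cubic.toPoly ⟨1, ((-1 : ℤ) : ℚ), ((-7 : ℤ) : ℚ), ((8 : ℤ) : ℚ)⟩) = 0)
    (hL : ∀ [NumberField ↥(ℚ⟮θ⟯ ⊔ (CyclotomicZp.zpExtension 2).layer (2 + 1))],
      Odd (classNumber ↥(ℚ⟮θ⟯ ⊔ (CyclotomicZp.zpExtension 2).layer (2 + 1))))
    (hlow : ∀ [NumberField ↥(ℚ⟮θ⟯ ⊔ (CyclotomicZp.zpExtension 2).layer 2)],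
      2 ^ 2 ≤ Nat.card (TotPosUnitsModSq ↥(ℚ⟮θ⟯ ⊔ (CyclotomicZp.zpExtension 2).layer 2)))
    (hsig : ∀ [NumberField ↥(ℚ⟮θ⟯ ⊔ (CyclotomicZp.zpExtension 2).layer (2 + 1))],
      2 ^ 22 ≤ Nat.card (Set.range (signVec (K := ↥(ℚ⟮θ⟯ ⊔ (CyclotomicZp.zpExtension 2).layer (2 + 1))))))
    :
    haveI := isElliptic_293200be1
    ∀ (κ : ZpExtension ℚ 2), κ.IsCyclotomic →
      ∃ (γ : Field.absoluteGaloisGroup ℚ) (D : (⟨0, 1, 0, -3388217033, -75912170159062⟩ : WeierstrassCurve ℚ).FineSelmerDualData κ γ),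
        Module.Finite ℤ_[2] (RestrictScalars ℤ_[2] (IwasawaAlgebra 2) D.X) :=
  conjA_two_of_eq_lp293200be1 (W' := (⟨0, ((1 : ℤ) : ℚ), 0, ((-3388217033 : ℤ) : ℚ), ((-75912170159062 : ℤ) : ℚ)⟩ : WeierstrassCurve ℚ)) (by norm_num)
    (fun κ hκ ↦ AddKatoTwo.conjA_two_293200be1_of_layerBounds₂₃' hθ hL hlow hsig κ hκ)

/-- **`BSD₂(293200be1)` with (A) from the THREE remaining layer data (`hK` kernel) and NO print fact for (A)**: GEN 3's rung `bsdp_two_293200be1_of_conjA`.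
Conditional on PRINT {`hSharp` (reading), `hGZK`, `hmod`, `hCT`}, RECORD `hr`, `#Ш_an = q`, the two VALUED slots and the three VALUED layer data (hL, hlow, hsig).
Nothing booked; BSD is not proved by this. [cite: Kato2004Asterisque, Thm. 12.5 (1)(3), 13.8, 14.14] [cite: EdgarMollinPeterson1986, Thm. 2.1] [cite: Miller2011LMS, Def. 1.1] -/
theorem bsdp_two_293200be1_layerBounds₂₃'
    (hSharp : Kato2004.rankZero_padicValNat_sha_add_padicValNat_tamagawa_le_at_two_of_irreducible_of_fineSelmerDual_fg)
    (hGZK : rank_eq_analyticRank_of_analyticRank_le_one) (hmod : hasEntireLFunction_rat)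
    (hCT : exists_casselsTate_pairing (K := ℚ))
    {θ : AlgebraicClosure ℚ} (hθ : aeval θ (Cubic.toPoly ⟨1, ((-1 : ℤ) : ℚ), ((-7 : ℤ) : ℚ), ((8 : ℤ) : ℚ)⟩) = 0)
    (hL : ∀ [NumberField ↥(ℚ⟮θ⟯ ⊔ (CyclotomicZp.zpExtension 2).layer (2 + 1))],
      Odd (classNumber ↥(ℚ⟮θ⟯ ⊔ (CyclotomicZp.zpExtension 2).layer (2 + 1))))
    (hlow : ∀ [NumberField ↥(ℚ⟮θ⟯ ⊔ (CyclotomicZp.zpExtension 2).layer 2)],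
      2 ^ 2 ≤ Nat.card (TotPosUnitsModSq ↥(ℚ⟮θ⟯ ⊔ (CyclotomicZp.zpExtension 2).layer 2)))
    (hsig : ∀ [NumberField ↥(ℚ⟮θ⟯ ⊔ (CyclotomicZp.zpExtension 2).layer (2 + 1))],
      2 ^ 22 ≤ Nat.card (Set.range (signVec (K := ↥(ℚ⟮θ⟯ ⊔ (CyclotomicZp.zpExtension 2).layer (2 + 1))))))
    (hr : haveI := isElliptic_293200be1; (⟨0, 1, 0, -3388217033, -75912170159062⟩ : WeierstrassCurve ℚ).analyticRank = 0)
    (hs₁ : Nat.card ((⟨0, 1, 0, -3388217033, -75912170159062⟩ : WeierstrassCurve ℚ).selmerGroup (2 ^ 2)) = 2 ^ 4)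
    (hs₂ : Nat.card ((⟨0, 1, 0, -3388217033, -75912170159062⟩ : WeierstrassCurve ℚ).selmerGroup (2 ^ (2 + 1))) = 2 ^ 6)
    {q : ℚ} (hq : haveI := isElliptic_293200be1; shaAn (⟨0, 1, 0, -3388217033, -75912170159062⟩ : WeierstrassCurve ℚ) = (q : ℂ)) (hv : padicValRat 2 q ≤ 6) :
    haveI := isElliptic_293200be1; haveI := isGloballyMinimal_293200be1
    BSDp (⟨0, 1, 0, -3388217033, -75912170159062⟩ : WeierstrassCurve ℚ) 2 := by
  exact bsdp_two_293200be1_of_conjA hSharp hGZK hmod hCT (conjA_two_293200be1_of_layerBounds₂₃'_kernelLit hθ hL hlow hsig) hr hs₁ hs₂ hq hv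

/-- **`BSD₂` ON THE WHOLE CLASS of `293200be1` with (A) from the THREE remaining layer data (`hK` kernel) and NO print fact for (A)**: GEN 3's class rung
(Cassels transport `hCassels`).  Nothing booked; BSD is not proved by this. [cite: Cassels1965ArithmeticVIII, Thm. 1.3] [cite: Kato2004Asterisque, Thm. 12.5 (1)(3)] -/
theorem bsdp_two_of_isIsogenous_293200be1_layerBounds₂₃'
    (hSharp : Kato2004.rankZero_padicValNat_sha_add_padicValNat_tamagawa_le_at_two_of_irreducible_of_fineSelmerDual_fg)
    (hGZK : rank_eq_analyticRank_of_analyticRank_le_one) (hmod : hasEntireLFunction_rat)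
    (hCT : exists_casselsTate_pairing (K := ℚ)) (hCassels : bsdRHS_eq_of_isIsogenous)
    {θ : AlgebraicClosure ℚ} (hθ : aeval θ (Cubic.toPoly ⟨1, ((-1 : ℤ) : ℚ), ((-7 : ℤ) : ℚ), ((8 : ℤ) : ℚ)⟩) = 0)
    (hL : ∀ [NumberField ↥(ℚ⟮θ⟯ ⊔ (CyclotomicZp.zpExtension 2).layer (2 + 1))],
      Odd (classNumber ↥(ℚ⟮θ⟯ ⊔ (CyclotomicZp.zpExtension 2).layer (2 + 1))))
    (hlow : ∀ [NumberField ↥(ℚ⟮θ⟯ ⊔ (CyclotomicZp.zpExtension 2).layer 2)],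
      2 ^ 2 ≤ Nat.card (TotPosUnitsModSq ↥(ℚ⟮θ⟯ ⊔ (CyclotomicZp.zpExtension 2).layer 2)))
    (hsig : ∀ [NumberField ↥(ℚ⟮θ⟯ ⊔ (CyclotomicZp.zpExtension 2).layer (2 + 1))],
      2 ^ 22 ≤ Nat.card (Set.range (signVec (K := ↥(ℚ⟮θ⟯ ⊔ (CyclotomicZp.zpExtension 2).layer (2 + 1))))))
    {W : WeierstrassCurve ℚ} [W.IsElliptic] [W.IsGloballyMinimal]
    (hiso : haveI := isElliptic_293200be1; IsIsogenous W (⟨0, 1, 0, -3388217033, -75912170159062⟩ : WeierstrassCurve ℚ)) (hr : W.analyticRank = 0)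
    (hs₁ : Nat.card ((⟨0, 1, 0, -3388217033, -75912170159062⟩ : WeierstrassCurve ℚ).selmerGroup (2 ^ 2)) = 2 ^ 4)
    (hs₂ : Nat.card ((⟨0, 1, 0, -3388217033, -75912170159062⟩ : WeierstrassCurve ℚ).selmerGroup (2 ^ (2 + 1))) = 2 ^ 6)
    {q : ℚ} (hq : haveI := isElliptic_293200be1; shaAn (⟨0, 1, 0, -3388217033, -75912170159062⟩ : WeierstrassCurve ℚ) = (q : ℂ)) (hv : padicValRat 2 q ≤ 6) :
    BSDp W 2 := by
  exact bsdp_two_of_isIsogenous_293200be1_of_conjA hSharp hGZK hmod hCT hCassels (conjA_two_293200be1_of_layerBounds₂₃'_kernelLit hθ hL hlow hsig) hiso hr hs₁ hs₂ hq hv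

end Summit.BirchSwinnertonDyer.BirchSwinnertonDyer.Theorems.AddPotGoodInstances

end
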